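/-
Copyright (c) 2026 the pub-hodgecm-mathlib formalisation cell (harness21).  Prover seat hodgecm-mathlib-K2Liu-p25 (g0), Track B «K2-LIT»,
#184♮ = hLiu418 = `stmt-HodgeConjecture-24832`; #42S organ S2, S2-asm road (γ): the SIGN FRAME of the doubled datum at a real place
(S2 desk K2Liu-p05 (g6) 15:33:20Z «→ K2Liu-p25: `K2LiuArchDoubledSignFrameTwo`»).  THEOREMS ONLY (no `def`, no `instance`, no notation,
no named-fact hypothesis, no `sorry`).
-/
import Summits.HodgeConjecture.HodgeConjecture.Theorems.K2LiuArchPlaceSecExp        -- ★ the 𝔻-datum letters (`cmGramEntry`, `cmPlaceOver`, `imagUnit`, …)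
import HarnessLib

/-!
# Crux `HLiu418`, #42S organ S2, road (γ): THE DOUBLED SIGN VECTOR HAS `n` POSITIVE AND `n` NEGATIVE ENTRIES — the block identifications
# `eSp : Fin n ≃ 𝔻⁺_σ`, `eSq : Fin n ≃ 𝔻⁻_σ` (at `n = 2`: `U(𝔻_σ) ≃ U(2,2)`)

Cell `hodgecm-mathlib`, crux item hLiu418 = `stmt-HodgeConjecture-24832` (helper lane `--supports`, count-neutral); S2 desk K2Liu-p05 (g6).
The sign vector of the doubled hermitian datum `𝔻 = 𝕍 ⊕ (−𝕍)` at a real place `σ` is `x_σ = (σ(t)∕c_σ, −σ(t)∕c_σ)` along ★ `e₂ = finSumFinEquiv` (★ `signVec`,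
`t = cmGramEntry`, all entries non-zero: ★ `signVec_ne_zero`); hence exactly one index of each pair `(e₂ (inl i), e₂ (inr i))` is positive:
* §1 (generic, frame-free) **`nonempty_fin_equiv_posIdx_of_pair`** ∕ **`nonempty_fin_equiv_negIdx_of_pair`** — for `x : Fin (n+n) → ℝ` with `x (e₂ (inr i)) = −x (e₂ (inl i)) ≠ 0`:
  `Fin n ≃ PosIdx x` and `Fin n ≃ NegIdx x` (explicit: `i ↦` the positive ∕ non-positive member of the pair; inverse `Sum.elim id id ∘ e₂⁻¹`);
* §2 **`exists_signFrame`** — `∃ (eSp : Fin n ≃ 𝔻⁺_σ) (eSq : Fin n ≃ 𝔻⁻_σ), True` for the doubled datum `(e, dV, dW)` at every real place `σ`; **`exists_signFrame_two`** — the same at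
  `n = 2` (`Fin 2 ≃ …`, the pair ★ p861386 `hsec_placeSec_relabel` and K2E5-p16's (F2′) consume); `eq_two_of_frame` — `n = 2` for the #42S frame `e : Fin 2 × Fin 1 ≃ Fin n`.
References: [KonnoKonno2007, §3.1 (3.1)]; [Kudla1994, §2 (the doubled space)]; [Folland1989, Ch. 4 §1 Prop. (4.6)].
HONEST LABEL: HC_CM is proved only modulo the 7 printed citations (2 remaining named inputs: hLiu418 = stmt-HodgeConjecture-24832,
h413 = stmt-HodgeConjecture-24833) until rung 0 closes; count-neutral helper, closes no socket.
-/

set_option autoImplicit false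
set_option linter.dupNamespace false -- the mandated namespace repeats `HodgeConjecture.HodgeConjecture`

noncomputable section

open scoped Matrix Classical
open NumberField NumberField.InfinitePlace NumberField.mixedEmbedding IsDedekindDomain
open Literature.NumberTheory.Automorphic Literature.NumberTheory.Automorphic.UnitaryGroup Literature.NumberTheory.Weil1964
open Literature.NumberTheory.GelbartRogawski1991 Literature.NumberTheory.GelbartRogawski1991.UnitaryDualPair
open Literature.NumberTheory.GelbartRogawski1991.UnitaryDualPair.LocalSplitting
open Literature.NumberTheory.GelbartRogawski1991.GRConstruction Literature.NumberTheory.K2Lit.SiegelDoubled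
open Summit.HodgeConjecture.HodgeConjecture.Cruxes.HLiu418

namespace Summit.HodgeConjecture.HodgeConjecture.Cruxes.HLiu418.K2LiuArchDoubledSignFrameTwo

/-! ## §1 (generic) a vector of opposite pairs has as many positive as non-positive entries -/

section Generic

variable {n : ℕ}

/-- **`Fin n ≃ PosIdx x`** for `x : Fin (n+n) → ℝ` whose `e₂`-pairs are opposite and non-zero (`i ↦` the positive member of the `i`-th pair).
[cite: KonnoKonno2007, §3.1 (3.1)] -/
theorem nonempty_fin_equiv_posIdx_of_pair (x : Fin (n + n) → ℝ) (hx0 : ∀ i : Fin n, x (finSumFinEquiv (Sum.inl i)) ≠ 0)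
    (hx : ∀ i : Fin n, x (finSumFinEquiv (Sum.inr i)) = -x (finSumFinEquiv (Sum.inl i))) : Nonempty (Fin n ≃ PosIdx x) := by
  have hneg : ∀ i : Fin n, ¬0 < x (finSumFinEquiv (Sum.inl i)) → 0 < x (finSumFinEquiv (Sum.inr i)) := fun i h => by
    rw [hx]; exact neg_pos.2 (lt_of_le_of_ne (not_lt.1 h) (hx0 i))
  refine ⟨Equiv.mk (fun i => if h : 0 < x (finSumFinEquiv (Sum.inl i)) then ⟨finSumFinEquiv (Sum.inl i), h⟩ else ⟨finSumFinEquiv (Sum.inr i), hneg i h⟩)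
    (fun k => Sum.elim id id (finSumFinEquiv.symm k.1)) (fun i => ?_) (fun k => ?_)⟩
  · by_cases h : 0 < x (finSumFinEquiv (Sum.inl i))
    · simp only [h, ↓reduceDIte, Equiv.symm_apply_apply, Sum.elim_inl, id]
    · simp only [h, ↓reduceDIte, Equiv.symm_apply_apply, Sum.elim_inr, id]
  · obtain ⟨k, hk⟩ := k
    obtain ⟨j, rfl⟩ := finSumFinEquiv.surjective k
    rcases j with i | i
    · have h : 0 < x (finSumFinEquiv (Sum.inl i)) := hk
      apply Subtype.ext
      simp only [Equiv.symm_apply_apply, Sum.elim_inl, id, h, ↓reduceDIte]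
    · have h : ¬0 < x (finSumFinEquiv (Sum.inl i)) := by
        intro h'
        rw [hx] at hk
        exact (lt_asymm (neg_pos.1 hk)) h'
      apply Subtype.ext
      simp only [Equiv.symm_apply_apply, Sum.elim_inr, id, h, ↓reduceDIte]

/-- **`Fin n ≃ NegIdx x`** likewise (`i ↦` the non-positive member of the `i`-th pair). [cite: KonnoKonno2007, §3.1 (3.1)] -/
theorem nonempty_fin_equiv_negIdx_of_pair (x : Fin (n + n) → ℝ) (hx0 : ∀ i : Fin n, x (finSumFinEquiv (Sum.inl i)) ≠ 0)
    (hx : ∀ i : Fin n, x (finSumFinEquiv (Sum.inr i)) = -x (finSumFinEquiv (Sum.inl i))) : Nonempty (Fin n ≃ NegIdx x) := by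
  have hneg : ∀ i : Fin n, 0 < x (finSumFinEquiv (Sum.inl i)) → ¬0 < x (finSumFinEquiv (Sum.inr i)) := fun i h => by
    rw [hx]; exact not_lt.2 (neg_nonpos.2 h.le)
  refine ⟨Equiv.mk (fun i => if h : 0 < x (finSumFinEquiv (Sum.inl i)) then ⟨finSumFinEquiv (Sum.inr i), hneg i h⟩ else ⟨finSumFinEquiv (Sum.inl i), h⟩)
    (fun k => Sum.elim id id (finSumFinEquiv.symm k.1)) (fun i => ?_) (fun k => ?_)⟩
  · by_cases h : 0 < x (finSumFinEquiv (Sum.inl i))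
    · simp only [h, ↓reduceDIte, Equiv.symm_apply_apply, Sum.elim_inr, id]
    · simp only [h, ↓reduceDIte, Equiv.symm_apply_apply, Sum.elim_inl, id]
  · obtain ⟨k, hk⟩ := k
    obtain ⟨j, rfl⟩ := finSumFinEquiv.surjective k
    rcases j with i | i
    · have h : ¬0 < x (finSumFinEquiv (Sum.inl i)) := hk
      apply Subtype.ext
      simp only [Equiv.symm_apply_apply, Sum.elim_inl, id, h, ↓reduceDIte]
    · have h : 0 < x (finSumFinEquiv (Sum.inl i)) := by
        have hk' : ¬0 < -x (finSumFinEquiv (Sum.inl i)) := by rw [← hx]; exact hk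
        rcases lt_trichotomy 0 (x (finSumFinEquiv (Sum.inl i))) with h' | h' | h'
        · exact h'
        · exact absurd h'.symm (hx0 i)
        · exact absurd (neg_pos.2 h') hk'
      apply Subtype.ext
      simp only [Equiv.symm_apply_apply, Sum.elim_inr, id, h, ↓reduceDIte]

end Generic

/-! ## §2 The sign frame of the doubled datum -/

section Frame

variable (L : Type) [Field L] [NumberField L] [IsCMField L]
variable {N M n : ℕ} (e : Fin N × Fin M ≃ Fin n)
  (dV : Fin N → L) (hdV : ∀ i, IsCMField.complexConj L (dV i) = dV i) (hdV0 : ∀ i, dV i ≠ 0)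
  (dW : Fin M → L) (hdW : ∀ i, IsCMField.complexConj L (dW i) = dW i) (hdW0 : ∀ i, dW i ≠ 0)

include hdV0 hdW0 in
/-- **THE SIGN FRAME OF `𝔻` AT A REAL PLACE**: `∃ (eSp : Fin n ≃ 𝔻⁺_σ) (eSq : Fin n ≃ 𝔻⁻_σ), True` — the doubled sign vector is `(σ(t)∕c_σ, −σ(t)∕c_σ)` along `e₂`, with
non-zero entries (★ `signVec_ne_zero`). [cite: KonnoKonno2007, §3.1 (3.1)] [cite: Kudla1994, §2 (the doubled space)] -/
theorem exists_signFrame (σ : {v : InfinitePlace (Fp L) // v.IsReal}) :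
    ∃ (_ : Fin n ≃ PosIdx (signVec (cmPlaceOver L) (fun k => Sum.elim (cmGramEntry L e dV hdV dW hdW) (-cmGramEntry L e dV hdV dW hdW) ((LocalSplitting.e₂ n).symm k)) (imagUnit L) σ)) (_ : Fin n ≃ NegIdx (signVec (cmPlaceOver L) (fun k => Sum.elim (cmGramEntry L e dV hdV dW hdW) (-cmGramEntry L e dV hdV dW hdW) ((LocalSplitting.e₂ n).symm k)) (imagUnit L) σ)), True := by
  have h0 := signVec_ne_zero (IsCMField.complexConj_ne_one L) (cmPlaceOver_smul L) (complexConj_imagUnit L) (imagUnit_ne_zero L)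
    (gramD_gram_realDiagonal_entry_ne_zero L e dV hdV dW hdW hdV0 hdW0) σ
  have hpair : ∀ i : Fin n, (signVec (cmPlaceOver L) (fun k => Sum.elim (cmGramEntry L e dV hdV dW hdW) (-cmGramEntry L e dV hdV dW hdW) ((LocalSplitting.e₂ n).symm k)) (imagUnit L) σ) (finSumFinEquiv (Sum.inr i)) = -(signVec (cmPlaceOver L) (fun k => Sum.elim (cmGramEntry L e dV hdV dW hdW) (-cmGramEntry L e dV hdV dW hdW) ((LocalSplitting.e₂ n).symm k)) (imagUnit L) σ) (finSumFinEquiv (Sum.inl i)) := by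
    intro i
    simp only [signVec, placeSignVec]
    rw [show (LocalSplitting.e₂ n).symm (finSumFinEquiv (Sum.inr i)) = Sum.inr i from (LocalSplitting.e₂ n).symm_apply_apply (Sum.inr i),
      show (LocalSplitting.e₂ n).symm (finSumFinEquiv (Sum.inl i)) = Sum.inl i from (LocalSplitting.e₂ n).symm_apply_apply (Sum.inl i),
      Sum.elim_inr, Sum.elim_inl, Pi.neg_apply, map_neg, neg_div]
  obtain ⟨eSp⟩ := nonempty_fin_equiv_posIdx_of_pair _ (fun i => h0 _) hpair
  obtain ⟨eSq⟩ := nonempty_fin_equiv_negIdx_of_pair _ (fun i => h0 _) hpair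
  exact ⟨eSp, eSq, trivial⟩

include hdV0 hdW0 in
/-- **AT `n = 2`: `eSp : Fin 2 ≃ 𝔻⁺_σ`, `eSq : Fin 2 ≃ 𝔻⁻_σ`** — the block identifications `U(𝔻_σ) ≃ U(2,2)` consumed by ★ p861386 `hsec_placeSec_relabel` (the one-place
homomorphism `ψ_σ := placeSec_𝔻 σ ∘ relabel (eSp, eSq)`) and by K2E5-p16's frame letter (F2′). [cite: KonnoKonno2007, §3.1 (3.1)] [cite: Kudla1994, §2 (the doubled space)] -/
theorem exists_signFrame_two (hn : n = 2) (σ : {v : InfinitePlace (Fp L) // v.IsReal}) :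
    ∃ (_ : Fin 2 ≃ PosIdx (signVec (cmPlaceOver L) (fun k => Sum.elim (cmGramEntry L e dV hdV dW hdW) (-cmGramEntry L e dV hdV dW hdW) ((LocalSplitting.e₂ n).symm k)) (imagUnit L) σ)) (_ : Fin 2 ≃ NegIdx (signVec (cmPlaceOver L) (fun k => Sum.elim (cmGramEntry L e dV hdV dW hdW) (-cmGramEntry L e dV hdV dW hdW) ((LocalSplitting.e₂ n).symm k)) (imagUnit L) σ)), True := by
  subst hn
  exact exists_signFrame L e dV hdV hdV0 dW hdW hdW0 σ

omit [NumberField L] [IsCMField L] in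
/-- `n = 2` for the #42S small frame `e : Fin 2 × Fin 1 ≃ Fin n`. [folklore] -/
theorem eq_two_of_frame (e₀ : Fin 2 × Fin 1 ≃ Fin n) : n = 2 := by
  have h := Fintype.card_congr e₀
  simp only [Fintype.card_prod, Fintype.card_fin] at h
  omega

end Frame

end Summit.HodgeConjecture.HodgeConjecture.Cruxes.HLiu418.K2LiuArchDoubledSignFrameTwo

end
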